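import Summits.Schanuel.Schanuel.Theses.RoyCriterion

/-!
# The diagonal rungs of a transcendence-degree ladder ARE the crux (line-death certificate,
crux `stmt-Schanuel-0463`, line `Sketch-ideator1-r1` = idea `liouville-window-ladder`)

Crux: `Summit.Schanuel.Schanuel.Theses.RoyCriterion.RoyThesisTyped = ∀ n, RoyCriterion n`.

The ladder line decomposes `RoyCriterion l` into rungs `Rung l r` ("no Roy point of rank `l` and
transcendence degree exactly `r`", `r < l`) and concludes the crux from the DIAGONAL rungs
`Rung l (l - 1)`, `l ≥ 1`, plus bookkeeping (`royThesisTyped_of_diagonal` in the skeleton). This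
file proves, from the tree alone (Roy 2001 Thm 1 `(b) ⇒ (a)` = `royThm1BtoA_holds`, Roy's
equivalence `Roy2001_iff_holds`, `royCriterion_zero`), that the conjunction of the diagonal rungs
is EQUIVALENT to the crux — so the line's one non-bookkeeping stub restates the crux (COSTUME):

* `RoyThesisTyped.le_trdeg_of_royHypothesis_of_royCriterion` — the off-diagonal rungs come from
  the lower rank: under `RoyCriterion k`, every Roy point `(y, α)` of rank `k + 1` (window (1),
  `RoyHypothesis`) has `k ≤ trdeg ℚ(y, α)` (torsion `α_j^D = e^{D y_j}` from Theorem 1, then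
  Schanuel rank `k` at the sub-tuple `D • (y ∘ Fin.castSucc)`).
* `RoyThesisTyped.crux_iff_diagonalRungs` — `RoyThesisTyped ↔ ∀ l ≥ 1, (no ℚ-free y : Fin l → ℂ,
  α ∈ (ℂˣ)^l with trdeg ℚ(y, α) = l - 1 satisfying RoyHypothesis in an admissible window)`.

No defs, no sorries, no named-fact hypotheses.
-/

set_option linter.dupNamespace false

noncomputable section

namespace Summit.Schanuel.Schanuel.Theorems

open Filter Complex
open Literature.NumberTheory.Transcendental

/-- **Off-diagonal rungs from the lower rank.** If Roy's criterion holds in rank `k`, then every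
Roy point of rank `k + 1` — `y` linearly independent over `ℚ`, `α j ≠ 0`, admissible window,
`RoyHypothesis y α s₀ s₁ t₀ t₁ u` — has `k ≤ trdeg_ℚ ℚ(y, α)`: Roy's Theorem 1 `(b) ⇒ (a)`
(`royThm1BtoA_holds`) gives `D ≥ 1` with `α_j^D = e^{D y_j}` for all `j`, the sub-tuple
`y' = D • (y ∘ Fin.castSucc)` is `ℚ`-free of rank `k`, `RoyCriterion k ⇔ SchanuelRank k`
(`Roy2001_iff_holds`) gives `k ≤ trdeg ℚ(y', e^{y'})`, and `ℚ(y', e^{y'}) ⊆ ℚ(y, α)`.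
[cite: Roy2001, §5 (1°)] -/
theorem RoyThesisTyped.le_trdeg_of_royHypothesis_of_royCriterion {k : ℕ} (hk : RoyCriterion k)
    {y α : Fin (k + 1) → ℂ} (hy : LinearIndependent ℚ y) (hα : ∀ j, α j ≠ 0)
    {s₀ s₁ t₀ t₁ u : ℝ} (hadm : RoyAdmissible s₀ s₁ t₀ t₁ u)
    (hhyp : RoyHypothesis y α s₀ s₁ t₀ t₁ u) :
    (k : Cardinal) ≤ Algebra.trdeg ℚ ↥(IntermediateField.adjoin ℚ (Set.range y ∪ Set.range α)) := by
  have hS : SchanuelRank k := (Roy2001_iff_holds k).mp hk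
  have hd : ∀ j, RoyConditionA (y j) (α j) := fun j =>
    royThm1BtoA_holds (y j) (α j) (hα j) s₀ s₁ t₀ t₁ u hadm (royConditionB_of_royHypothesis hhyp j)
  choose d hd1 hd2 using hd
  set D : ℕ := ∏ j, d j with hD
  have hD0 : 0 < D := Finset.prod_pos fun j _ => hd1 j
  have hαD : ∀ j, α j ^ D = cexp (D * y j) := by
    intro j
    obtain ⟨e, he⟩ : d j ∣ D := Finset.dvd_prod_of_mem _ (Finset.mem_univ j)
    rw [he, pow_mul, hd2 j, ← Complex.exp_nat_mul]
    push_cast; ring_nf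
  set y' : Fin k → ℂ := fun j => (D : ℂ) * y (Fin.castSucc j) with hy'_def
  have hy' : LinearIndependent ℚ y' := by
    have hsub : LinearIndependent ℚ (y ∘ Fin.castSucc) := hy.comp _ (Fin.castSucc_injective _)
    have hDq : (D : ℚ) ≠ 0 := by exact_mod_cast hD0.ne'
    have := hsub.units_smul (fun _ => Units.mk0 (D : ℚ) hDq)
    convert this using 1
    ext j
    simp [hy'_def, Units.smul_def, Rat.smul_def]
  have hle : IntermediateField.adjoin ℚ (Set.range y' ∪ Set.range (cexp ∘ y')) ≤
      IntermediateField.adjoin ℚ (Set.range y ∪ Set.range α) := by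
    refine IntermediateField.adjoin_le_iff.mpr ?_
    rintro x (⟨j, rfl⟩ | ⟨j, rfl⟩)
    · exact mul_mem (natCast_mem _ D)
        (IntermediateField.subset_adjoin _ _ (Or.inl ⟨Fin.castSucc j, rfl⟩))
    · change cexp ((D : ℂ) * y (Fin.castSucc j)) ∈ _
      rw [← hαD (Fin.castSucc j)]
      exact pow_mem (IntermediateField.subset_adjoin ℚ (Set.range y ∪ Set.range α)
        (Or.inr ⟨Fin.castSucc j, rfl⟩)) D
  calc (k : Cardinal)
      ≤ Algebra.trdeg ℚ ↥(IntermediateField.adjoin ℚ (Set.range y' ∪ Set.range (cexp ∘ y'))) :=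
        hS y' hy'
    _ ≤ Algebra.trdeg ℚ ↥(IntermediateField.adjoin ℚ (Set.range y ∪ Set.range α)) :=
        trdeg_le_of_injective (IntermediateField.inclusion hle)
          (IntermediateField.inclusion_injective hle)

/-- **The diagonal rungs are the crux.** `RoyThesisTyped` holds iff for every rank `l ≥ 1` there is
no ESSENTIAL Roy point: a `ℚ`-linearly independent `y : Fin l → ℂ` with `α ∈ (ℂˣ)^l`,
`trdeg_ℚ ℚ(y, α) = l - 1` exactly, satisfying `RoyHypothesis` in some admissible window. (`→` is
immediate; `←` is strong induction on the rank: at rank `k + 1` the lower rank `k`, already settled,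
pins the transcendence degree of a would-be counterexample to exactly `k` by
`le_trdeg_of_royHypothesis_of_royCriterion`, and the diagonal rung excludes it.) Consequently a
skeleton whose stubs are bookkeeping plus the diagonal rungs restates the crux. [folklore] -/
theorem RoyThesisTyped.crux_iff_diagonalRungs :
    Summit.Schanuel.Schanuel.Theses.RoyCriterion.RoyThesisTyped ↔
    ∀ l : ℕ, 1 ≤ l → ∀ (y α : Fin l → ℂ), LinearIndependent ℚ y → (∀ j, α j ≠ 0) →
      Algebra.trdeg ℚ ↥(IntermediateField.adjoin ℚ (Set.range y ∪ Set.range α)) = ((l - 1 : ℕ) : Cardinal) →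
      ∀ (s₀ s₁ t₀ t₁ u : ℝ), RoyAdmissible s₀ s₁ t₀ t₁ u → ¬ RoyHypothesis y α s₀ s₁ t₀ t₁ u := by
  constructor
  · intro hX l hl y α hy hα htr s₀ s₁ t₀ t₁ u hadm hhyp
    have h := hX l y α hy hα s₀ s₁ t₀ t₁ u hadm hhyp
    rw [htr] at h
    have h' : l ≤ l - 1 := by exact_mod_cast h
    omega
  · intro hdiag l
    induction l using Nat.strong_induction_on with
    | _ l ih =>
      cases l with
      | zero => exact royCriterion_zero
      | succ k =>
        intro y α hy hα s₀ s₁ t₀ t₁ u hadm hhyp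
        by_contra hlt
        push Not at hlt
        have hk : RoyCriterion k := ih k (Nat.lt_succ_self k)
        have hge := RoyThesisTyped.le_trdeg_of_royHypothesis_of_royCriterion hk hy hα hadm hhyp
        have heq : Algebra.trdeg ℚ ↥(IntermediateField.adjoin ℚ (Set.range y ∪ Set.range α)) =
            ((k + 1 - 1 : ℕ) : Cardinal) := by
          rw [Nat.add_sub_cancel]
          refine le_antisymm ?_ hge
          have : Algebra.trdeg ℚ ↥(IntermediateField.adjoin ℚ (Set.range y ∪ Set.range α)) <
              Order.succ (k : Cardinal) := by
            rw [Cardinal.succ_natCast]; exact_mod_cast hlt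
          exact Order.lt_succ_iff.mp this
        exact hdiag (k + 1) (Nat.succ_pos k) y α hy hα heq s₀ s₁ t₀ t₁ u hadm hhyp

end Summit.Schanuel.Schanuel.Theorems

end
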